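import Summits.AtomisticToContinuum.Crystallization.Theorems.ChessboardParticlePlanesPeriodicWindowsStubWideGapSyndetic
import Summits.AtomisticToContinuum.Crystallization.Theorems.ChessboardParticlePlanesPeriodicWindowsStubLayeredPrisms
import Summits.AtomisticToContinuum.Crystallization.Theorems.ChessboardParticlePlanesPeriodicWindowsGapSqueezeCompetitor2
import Summits.AtomisticToContinuum.Crystallization.Theorems.PhononSlackCertificatesPeriodicGivenLayeredClosing3
import Literature.MathematicalPhysics.StatisticalMechanics.CrystallizationSymmetries
import Literature.MathematicalPhysics.StatisticalMechanics.LocalLimitOfGroundStates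

/-!
# Crux `PeriodicWindows` (stmt-AtomisticToContinuum-3240), line `dense-laminar-hull` — stub GS `stub_gapSqueeze`
# (every interlayer gap of an aligned layered hull point is `≤ 1`; lead c11)

The numerics-free first half of P3b2 `stub_closingOverTorus` (skeleton rev 7, `Cruxes/PeriodicWindows/Lines/dense_laminar_hull.lean`):
let `x` be a sequence of Lennard-Jones ground states and `Z = B '' {i v₁(a) + j v₂(a) + δ m + z m e₃}` a rooted, rooted-uniformly
recurrent, `ρ₀`-dense, exactly laminar, `7/10`-separated point of its rotated hull, written as a general layered set (the output of
P3b1 `stub_layerData`). Then `z (m+1) - z m ≤ 1` for every `m`.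

Proof (density closing with the COMPRESSION competitor). Suppose `z (m₀+1) - z m₀ = 1 + 2η > 1`.
* `stub_wideGapSyndetic` (GS1, p163884): gaps `≥ 1 + η` recur with bounded index gaps `G`.
* `gs_reduce_offsets`: the offsets may be taken in a fundamental cell, `‖δ m‖ ≤ 2a` (re-index `i, j`).
* `gsc_compression` / `gsc_competitor` (p164331 / p164584): the compressed heights `z'` (increments `min(gap, 1)`) define a
  `7/10`-separated layered set `Z'` whose site energies are site by site `≤` those of `Z`, and smaller by a fixed `c > 0` at
  every site lying below a gap `≥ 1 + η`.
* `stub_layeredPrisms` (GS2, p164098): the prisms `W(0, n, K) ⊆ Z`, `W'(0, n, K) ⊆ Z'` have `nK²` points and boundary functional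
  `≤ C (nK + K²)`.
* `gs_hull_translate` + `LayeredHull.wb_upper` (item 11779): `Z` lies in the translation hull of the ROTATED ground-state sequence
  `A_{σ⁻¹ N} ∘ x N`, so (U) `Σ_W e_p(Z) ≤ 2 E(nK²) + C_U ∂(W)`; `LayeredHull.wb_lower`: (L) `Σ_{W'} e_p(Z') ≥ 2 E(nK²) - C_L ∂(W')`.
* Counting (`LayeredHull.clo_count`): with `n = K = n'(G+1)`, `c K² n' ≤ Σ_W e(Z) - Σ_{W'} e(Z') ≤ (|C_U| + |C_L|) C_b · 2K²`, i.e.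
  `n' ≤ 2 (|C_U| + |C_L|) C_b / c` — false for `n'` large.

[folklore]
-/

noncomputable section

namespace Summit.AtomisticToContinuum.Crystallization.Theorems.PeriodicWindowsDenseLaminarHull

open Literature.MathematicalPhysics.StatisticalMechanics Filter Metric
open scoped BigOperators

/-! ## From the rotated hull to the translation hull of a rotated ground-state sequence -/

/-- **Rotated hull ⇒ translation hull of rotated ground states.** If `Z` is two-way matched on every ball by rotated
translates `A_j (x (σ j)) + τ_j` of a subsequence of a ground-state sequence `x`, then `Z` is matched by TRANSLATES of the
ground-state sequence `x' N := A_{σ⁻¹ N} ∘ x N` frequently in `N` (the hypothesis shape of the window bound (U)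
`LayeredHull.wb_upper`). [folklore] -/
theorem gs_hull_translate {x : (N : ℕ) → (Fin N → EuclideanSpace ℝ (Fin 3))}
    (hx : ∀ N, IsGroundState lennardJones (x N)) {Z : Set (EuclideanSpace ℝ (Fin 3))}
    (hhull : ∃ (σ : ℕ → ℕ) (τ : ℕ → EuclideanSpace ℝ (Fin 3))
        (A : ℕ → (EuclideanSpace ℝ (Fin 3) ≃ₗᵢ[ℝ] EuclideanSpace ℝ (Fin 3))),
      StrictMono σ ∧ ∀ R ε : ℝ, 0 < ε → ∀ᶠ j in Filter.atTop,
        BallMatch ε R 0 (Set.range fun i => A j (x (σ j) i) + τ j) Z) :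
    ∃ x' : (N : ℕ) → (Fin N → EuclideanSpace ℝ (Fin 3)), (∀ N, IsGroundState lennardJones (x' N)) ∧
      ∀ R ε : ℝ, 0 < ε → ∃ᶠ N in atTop, ∃ t : EuclideanSpace ℝ (Fin 3),
        (∀ p ∈ Z, ‖p‖ ≤ R → ∃ i : Fin N, dist (x' N i + t) p ≤ ε) ∧
        (∀ i : Fin N, ‖x' N i + t‖ ≤ R → ∃ p ∈ Z, dist (x' N i + t) p ≤ ε) := by
  classical
  obtain ⟨σ, τ, A, hσ, hlim⟩ := hhull
  refine ⟨fun N i => A (Function.invFun σ N) (x N i), fun N =>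
    (isGroundState_comp_isometry_iff lennardJones (A (Function.invFun σ N)).isometry (x := x N)).2 (hx N),
    fun R ε hε => ?_⟩
  rw [Filter.frequently_atTop]
  intro M
  obtain ⟨j, hMj, hj⟩ := ((eventually_ge_atTop M).and (hlim R ε hε)).exists
  have hinv : Function.invFun σ (σ j) = j := Function.leftInverse_invFun hσ.injective j
  refine ⟨σ j, hMj.trans (hσ.id_le j), τ j, ?_⟩
  have hj' : BallMatch ε R 0 (Set.range fun i => A (Function.invFun σ (σ j)) (x (σ j) i) + τ j) Z := by
    rw [hinv]; exact hj
  exact (ballMatch_zero_range_iff _ _ _).1 hj'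

/-! ## Offsets in a fundamental cell -/

/-- **Reducing the offsets.** The horizontal offsets of a general layered set may be taken of norm `≤ 2a`: subtract from
`δ m` the nearest-below lattice vector (`gsc_cover`) and re-index the sites of layer `m`. The layered set is unchanged for
every height function. [folklore] -/
theorem gs_reduce_offsets {a : ℝ} (ha : 0 < a) (B : EuclideanSpace ℝ (Fin 3) ≃ₗᵢ[ℝ] EuclideanSpace ℝ (Fin 3))
    (δ : ℤ → EuclideanSpace ℝ (Fin 3)) (hδ : ∀ m : ℤ, (δ m) 2 = 0) :
    ∃ δ' : ℤ → EuclideanSpace ℝ (Fin 3), (∀ m : ℤ, (δ' m) 2 = 0) ∧ (∀ m : ℤ, ‖δ' m‖ ≤ 2 * a) ∧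
      ∀ w : ℤ → ℝ, (fun p => B p) '' {p | ∃ m i j : ℤ, p = ((i : ℝ) • triangularVec₁ a) +
          ((j : ℝ) • triangularVec₂ a) + δ m + (w m • layerNormal 1)} =
        (fun p => B p) '' {p | ∃ m i j : ℤ, p = ((i : ℝ) • triangularVec₁ a) +
          ((j : ℝ) • triangularVec₂ a) + δ' m + (w m • layerNormal 1)} := by
  choose c₁ c₂ hc using fun m => gsc_cover ha (δ m) (hδ m)
  refine ⟨fun m => δ m - ((c₁ m : ℝ) • triangularVec₁ a + (c₂ m : ℝ) • triangularVec₂ a), fun m => ?_, hc, fun w => ?_⟩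
  · rw [PiLp.sub_apply, PiLp.add_apply, PiLp.smul_apply, PiLp.smul_apply, hδ, gsc_triangularVec₁_two,
      gsc_triangularVec₂_two]
    simp
  · ext q
    constructor
    · rintro ⟨p, ⟨m, i, j, rfl⟩, rfl⟩
      refine ⟨_, ⟨m, i + c₁ m, j + c₂ m, rfl⟩, ?_⟩
      dsimp only
      congr 1
      push_cast
      module
    · rintro ⟨p, ⟨m, i, j, rfl⟩, rfl⟩
      refine ⟨_, ⟨m, i - c₁ m, j - c₂ m, rfl⟩, ?_⟩
      dsimp only
      congr 1
      push_cast
      module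

/-! ## The stub -/

/-- **STUB GS `stub_gapSqueeze` (the gap squeeze; numerics-free).** Let `x` be a sequence of Lennard-Jones ground states
and `Z` a rooted, rooted-uniformly recurrent, `ρ₀`-dense, exactly laminar, `7/10`-separated point of its rotated hull which
is the horizontal-isometric image `B '' {i v₁(a) + j v₂(a) + δ m + z m e₃}` of a general layered set (the output of P3b1).
Then every interlayer gap is at most `1`. Density closing with the compression competitor: a gap `> 1` makes wide gaps
syndetic (GS1); compressing every gap to `min(gap, 1)` gives a `7/10`-separated set whose site energies are site by site
not larger and drop by a fixed `c > 0` below every wide gap (`gsc_competitor`); on the prisms of GS2 at equal cardinality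
the window bounds (U) (`LayeredHull.wb_upper`, for `Z` in the translation hull of the rotated ground states) and (L)
(`LayeredHull.wb_lower`, for the compressed set) leave `c K² n' ≤ 2 (|C_U| + |C_L|) C_b K²` with `n = K = n'(G+1)`,
false for `n'` large. [folklore] -/
theorem stub_gapSqueeze : ∀ ρ₀ : ℝ, 0 < ρ₀ →
    ∀ x : (N : ℕ) → (Fin N → EuclideanSpace ℝ (Fin 3)), (∀ N, IsGroundState lennardJones (x N)) →
    ∀ Z : Set (EuclideanSpace ℝ (Fin 3)), (0 : EuclideanSpace ℝ (Fin 3)) ∈ Z →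
    (∃ (σ : ℕ → ℕ) (τ : ℕ → EuclideanSpace ℝ (Fin 3))
        (A : ℕ → (EuclideanSpace ℝ (Fin 3) ≃ₗᵢ[ℝ] EuclideanSpace ℝ (Fin 3))),
      StrictMono σ ∧ ∀ R ε : ℝ, 0 < ε → ∀ᶠ j in Filter.atTop,
        BallMatch ε R 0 (Set.range fun i => A j (x (σ j) i) + τ j) Z) →
    (∀ c : EuclideanSpace ℝ (Fin 3), ∃ p ∈ Z, dist p c ≤ ρ₀) →
    (∀ p ∈ Z, ∀ q ∈ Z, p 2 ≠ q 2 → (3 : ℝ) / 4 ≤ |p 2 - q 2|) →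
    (∀ p ∈ Z, ∀ q ∈ Z, p ≠ q → (7 : ℝ) / 10 ≤ dist p q) →
    (∀ R ε : ℝ, 0 < ε → ∃ G : ℝ, ∀ w ∈ Z, ∃ g ∈ Z, dist g w ≤ G ∧
      BallMatch ε R 0 ((fun p => p - g) '' Z) Z) →
    ∀ a : ℝ, 0 < a →
    ∀ (B : EuclideanSpace ℝ (Fin 3) ≃ₗᵢ[ℝ] EuclideanSpace ℝ (Fin 3)) (δ : ℤ → EuclideanSpace ℝ (Fin 3)) (z : ℤ → ℝ),
    (∀ p : EuclideanSpace ℝ (Fin 3), (B p) 2 = p 2) → (∀ m : ℤ, (δ m) 2 = 0) → δ 0 = 0 → z 0 = 0 → StrictMono z →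
    (∀ m : ℤ, (3 : ℝ) / 4 ≤ z (m + 1) - z m) → (∀ m : ℤ, z (m + 1) - z m ≤ 2 * ρ₀) →
    Z = (fun p => B p) '' {p | ∃ m i j : ℤ, p = ((i : ℝ) • triangularVec₁ a) +
      ((j : ℝ) • triangularVec₂ a) + δ m + (z m • layerNormal 1)} →
    ∀ m : ℤ, z (m + 1) - z m ≤ 1 := by
  classical
  intro ρ₀ _hρ₀ x hx Z _h0 hhull _hdense _hlam hsep hrec a ha B δ z hB hδ _hδ0 _hz0 hz hgap hgap' hZ
  by_contra hcon
  simp only [not_forall, not_le] at hcon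
  obtain ⟨m₀, hm₀⟩ := hcon
  -- the width `η`
  obtain ⟨η, hη, hwide0⟩ : ∃ η : ℝ, 0 < η ∧ 1 + 2 * η ≤ z (m₀ + 1) - z m₀ :=
    ⟨(z (m₀ + 1) - z m₀ - 1) / 2, by linarith, by linarith⟩
  -- (1) wide gaps are syndetic (GS1)
  obtain ⟨G, hG⟩ := stub_wideGapSyndetic a ha B δ z hB hδ hz hgap Z hZ hrec η hη m₀ hwide0
  -- (2) offsets in a fundamental cell
  obtain ⟨δ', hδ', hδ'D, hreidx⟩ := gs_reduce_offsets ha B δ hδ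
  have hZ' : Z = (fun p => B p) '' {p | ∃ m i j : ℤ, p = ((i : ℝ) • triangularVec₁ a) +
      ((j : ℝ) • triangularVec₂ a) + δ' m + (z m • layerNormal 1)} := by rw [hZ]; exact hreidx z
  -- (3) the compressed heights and the compressed set
  obtain ⟨z', _hz'0, hz', hz'mono, _hz'abs⟩ := gsc_compression z hgap
  have hgapz' : ∀ m : ℤ, (3 : ℝ) / 4 ≤ z' (m + 1) - z' m := fun m => by
    rw [hz' m]; exact le_min (hgap m) (by norm_num)
  obtain ⟨Z', hZ'def⟩ : ∃ Z' : Set (EuclideanSpace ℝ (Fin 3)), Z' = (fun p => B p) '' {p | ∃ m i j : ℤ,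
      p = ((i : ℝ) • triangularVec₁ a) + ((j : ℝ) • triangularVec₂ a) + δ' m + (z' m • layerNormal 1)} := ⟨_, rfl⟩
  -- (4) the competitor facts
  obtain ⟨hsepZ', hsite, c, hc, hgain⟩ :=
    gsc_competitor a η (2 * ρ₀) ha hη B δ' z z' hB hδ' hz hgap hgap' hz' Z Z' hZ' hZ'def hsep
  -- (5) the prisms (GS2) for `Z` and `Z'`
  obtain ⟨CZ, hprism⟩ := stub_layeredPrisms a (2 * a) ha B δ' z hB hδ' hδ'D hz hgap
  obtain ⟨CZ', hprism'⟩ := stub_layeredPrisms a (2 * a) ha B δ' z' hB hδ' hδ'D hz'mono hgapz'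
  -- (6) the window bounds: (U) for `Z` (translation hull of the rotated ground states), (L) for `Z'`
  obtain ⟨CU, hU⟩ := LayeredHull.wb_upper
  obtain ⟨x₁, hx₁, hH⟩ := gs_hull_translate hx hhull
  obtain ⟨CL, hL⟩ := LayeredHull.wb_lower (7 / 10) (by norm_num)
  -- (7) the sizes: `n'` blocks of `G + 1` layers, `n = K = n'(G+1)`
  obtain ⟨Cb, hCb⟩ : ∃ Cb : ℝ, Cb = |CZ| + |CZ'| := ⟨_, rfl⟩
  have hCb0 : 0 ≤ Cb := by rw [hCb]; positivity
  have hCZ : |CZ| ≤ Cb := by rw [hCb]; linarith [abs_nonneg CZ']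
  have hCZ' : |CZ'| ≤ Cb := by rw [hCb]; linarith [abs_nonneg CZ]
  obtain ⟨n', hn'⟩ := exists_nat_gt (2 * ((|CU| + |CL|) * Cb) / c)
  have hn'pos : 0 < n' := by
    have h0 : (0 : ℝ) ≤ 2 * ((|CU| + |CL|) * Cb) / c := by positivity
    exact_mod_cast h0.trans_lt hn'
  obtain ⟨n, hndef⟩ : ∃ n : ℕ, n = n' * (G + 1) := ⟨_, rfl⟩
  have hnpos : 0 < n := by rw [hndef]; exact Nat.mul_pos hn'pos (Nat.succ_pos G)
  have hKpos : (0 : ℝ) < (n : ℝ) := by exact_mod_cast hnpos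
  -- the parametrisations of `Z` and `Z'` by `ℤ × ℕ × ℕ` and the index box
  obtain ⟨P, hP⟩ : ∃ P : ℤ × (ℕ × ℕ) → EuclideanSpace ℝ (Fin 3), P = fun t => B (((t.2.1 : ℝ) • triangularVec₁ a) +
    ((t.2.2 : ℝ) • triangularVec₂ a) + δ' t.1 + (z t.1 • layerNormal 1)) := ⟨_, rfl⟩
  obtain ⟨P', hP'⟩ : ∃ P' : ℤ × (ℕ × ℕ) → EuclideanSpace ℝ (Fin 3), P' = fun t => B (((t.2.1 : ℝ) • triangularVec₁ a) +
    ((t.2.2 : ℝ) • triangularVec₂ a) + δ' t.1 + (z' t.1 • layerNormal 1)) := ⟨_, rfl⟩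
  obtain ⟨box, hbox⟩ : ∃ box : Finset (ℤ × (ℕ × ℕ)),
    box = (Finset.Ico (0 : ℤ) (0 + n)) ×ˢ ((Finset.range n) ×ˢ (Finset.range n)) := ⟨_, rfl⟩
  have hPt : ∀ (m : ℤ) (i j : ℕ), P (m, (i, j)) = B ((((i : ℤ) : ℝ)) • triangularVec₁ a +
      (((j : ℤ) : ℝ)) • triangularVec₂ a + δ' m + (z m • layerNormal 1)) := fun m i j => by
    rw [hP]; simp
  have hP't : ∀ (m : ℤ) (i j : ℕ), P' (m, (i, j)) = B ((((i : ℤ) : ℝ)) • triangularVec₁ a +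
      (((j : ℤ) : ℝ)) • triangularVec₂ a + δ' m + (z' m • layerNormal 1)) := fun m i j => by
    rw [hP']; simp
  have hinjP : Function.Injective P := by
    rintro ⟨m, i, j⟩ ⟨m', i', j'⟩ h
    rw [hPt, hPt] at h
    have := gsc_param_injective (a := a) ha hB hδ' hz.injective (a₁ := (m, (i : ℤ), (j : ℤ)))
      (a₂ := (m', (i' : ℤ), (j' : ℤ))) h
    simp only [Prod.mk.injEq, Nat.cast_inj] at this
    rw [this.1, this.2.1, this.2.2]
  have hinjP' : Function.Injective P' := by
    rintro ⟨m, i, j⟩ ⟨m', i', j'⟩ h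
    rw [hP't, hP't] at h
    have := gsc_param_injective (a := a) ha hB hδ' hz'mono.injective (a₁ := (m, (i : ℤ), (j : ℤ)))
      (a₂ := (m', (i' : ℤ), (j' : ℤ))) h
    simp only [Prod.mk.injEq, Nat.cast_inj] at this
    rw [this.1, this.2.1, this.2.2]
  -- the two prisms with `m₁ = 0`, `n` layers, `K = n` (GS2)
  obtain ⟨hWsub, hWcard, hWbd⟩ := hprism 0 n n Z hZ' (box.image P) (by rw [hbox, hP])
  obtain ⟨hW'sub, hW'card, hW'bd⟩ := hprism' 0 n n Z' hZ'def (box.image P') (by rw [hbox, hP'])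
  -- (U) and (L), boundary terms absorbed
  have hbd0 : ∀ (S : Set (EuclideanSpace ℝ (Fin 3))) (W : Finset (EuclideanSpace ℝ (Fin 3))),
      0 ≤ ∑ p ∈ W, (1 + Metric.infDist p (S \ (↑W : Set (EuclideanSpace ℝ (Fin 3)))))⁻¹ ^ 3 := fun S W =>
    Finset.sum_nonneg fun p _ => pow_nonneg (inv_nonneg.2 (add_nonneg zero_le_one Metric.infDist_nonneg)) 3
  have hnn : (0 : ℝ) ≤ (n : ℝ) * n + (n : ℝ) ^ 2 := by positivity
  have hWbd' : ∑ p ∈ box.image P, (1 + Metric.infDist p (Z \ (↑(box.image P) : Set (EuclideanSpace ℝ (Fin 3)))))⁻¹ ^ 3 ≤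
      Cb * ((n : ℝ) * n + (n : ℝ) ^ 2) := by
    refine hWbd.trans ?_
    have h1 : CZ * ((n : ℝ) * n + (n : ℝ) ^ 2) ≤ |CZ| * ((n : ℝ) * n + (n : ℝ) ^ 2) :=
      mul_le_mul_of_nonneg_right (le_abs_self _) hnn
    exact h1.trans (mul_le_mul_of_nonneg_right hCZ hnn)
  have hW'bd' : ∑ p ∈ box.image P', (1 + Metric.infDist p (Z' \ (↑(box.image P') : Set (EuclideanSpace ℝ (Fin 3)))))⁻¹ ^ 3 ≤
      Cb * ((n : ℝ) * n + (n : ℝ) ^ 2) := by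
    refine hW'bd.trans ?_
    have h1 : CZ' * ((n : ℝ) * n + (n : ℝ) ^ 2) ≤ |CZ'| * ((n : ℝ) * n + (n : ℝ) ^ 2) :=
      mul_le_mul_of_nonneg_right (le_abs_self _) hnn
    exact h1.trans (mul_le_mul_of_nonneg_right hCZ' hnn)
  have hUw := hU x₁ hx₁ Z hH (box.image P) hWsub
  have hLw := hL Z' hsepZ' (box.image P') hW'sub
  rw [hWcard] at hUw
  rw [hW'card] at hLw
  have hUw' := LayeredHull.clo_absorb_upper hUw hWbd' (hbd0 _ _)
  have hLw' := LayeredHull.clo_absorb_lower hLw hW'bd' (hbd0 _ _)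
  -- the two prism sums as sums over the index box
  rw [Finset.sum_image fun t _ t' _ h => hinjP h] at hUw'
  rw [Finset.sum_image fun t _ t' _ h => hinjP' h] at hLw'
  -- termwise comparison on the box: `e'(P' t) + c · 1[wide t.1] ≤ e(P t)`
  have hterm : ∀ t ∈ box,
      (∑' q : {q : EuclideanSpace ℝ (Fin 3) // q ∈ Z' ∧ q ≠ P' t}, lennardJones (dist (P' t) (q : EuclideanSpace ℝ (Fin 3)))) +
        c * (if 1 + η ≤ z (t.1 + 1) - z t.1 then (1 : ℝ) else 0) ≤
      ∑' q : {q : EuclideanSpace ℝ (Fin 3) // q ∈ Z ∧ q ≠ P t}, lennardJones (dist (P t) (q : EuclideanSpace ℝ (Fin 3))) := by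
    rintro ⟨m, i, j⟩ -
    rw [hPt, hP't]
    dsimp only
    split_ifs with hw
    · rw [mul_one]; exact hgain m i j hw
    · rw [mul_zero, add_zero]; exact hsite m i j
  have hsum_le := Finset.sum_le_sum hterm
  rw [Finset.sum_add_distrib, ← Finset.mul_sum] at hsum_le
  -- counting the wide gaps in the block
  have hlayer : ∑ t ∈ box, (if 1 + η ≤ z (t.1 + 1) - z t.1 then (1 : ℝ) else 0) =
      (n : ℝ) ^ 2 * ∑ m ∈ Finset.Ico (0 : ℤ) (0 + n), (if 1 + η ≤ z (m + 1) - z m then (1 : ℝ) else 0) := by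
    rw [hbox]
    exact LayeredHull.cake_sum_box_layer (fun m => if 1 + η ≤ z (m + 1) - z m then (1 : ℝ) else 0) 0 n n
  have hcount : (n' : ℝ) ≤ ∑ m ∈ Finset.Ico (0 : ℤ) (0 + ((n' * (G + 1) : ℕ) : ℤ)),
      (if 1 + η ≤ z (m + 1) - z m then (1 : ℝ) else 0) :=
    LayeredHull.clo_count (fun m => 1 + η ≤ z (m + 1) - z m) G 0 (fun m => hG m) n'
  rw [← hndef] at hcount
  have hcount' : (n : ℝ) ^ 2 * n' ≤ ∑ t ∈ box, (if 1 + η ≤ z (t.1 + 1) - z t.1 then (1 : ℝ) else 0) := by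
    rw [hlayer]
    exact mul_le_mul_of_nonneg_left hcount (by positivity)
  -- the energy inequality `c n² n' ≤ (|CU| + |CL|) Cb (n·n + n²)`, divided by `n² > 0`
  have hgainTot : c * ((n : ℝ) ^ 2 * n') ≤ (|CU| + |CL|) * (Cb * ((n : ℝ) * n + (n : ℝ) ^ 2)) := by
    nlinarith [mul_le_mul_of_nonneg_left hcount' hc.le, hsum_le, hUw', hLw', abs_nonneg CU, abs_nonneg CL]
  have hK2 : (0 : ℝ) < (n : ℝ) ^ 2 := by positivity
  have hmain : (n : ℝ) ^ 2 * (c * n') ≤ (n : ℝ) ^ 2 * (2 * ((|CU| + |CL|) * Cb)) := by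
    have e : (|CU| + |CL|) * (Cb * ((n : ℝ) * n + (n : ℝ) ^ 2)) = (n : ℝ) ^ 2 * (2 * ((|CU| + |CL|) * Cb)) := by ring
    rw [e] at hgainTot
    linarith
  have hdiv : c * n' ≤ 2 * ((|CU| + |CL|) * Cb) := le_of_mul_le_mul_left hmain hK2
  have : (n' : ℝ) ≤ 2 * ((|CU| + |CL|) * Cb) / c := by
    rw [le_div_iff₀ hc]; linarith
  linarith

end Summit.AtomisticToContinuum.Crystallization.Theorems.PeriodicWindowsDenseLaminarHull

end
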